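import Summits.Parity.GeneralizedHardyLittlewood.Theorems.TwinLowerDensityToGHLUniformUpperBoundCount
import Summits.Parity.GeneralizedHardyLittlewood.Theorems.PairsToGHL.Negative.ShiftPairDictionary
import Literature.NumberTheory.Sieve.LinearEquationsInPrimesDimOne
import HarnessLib

/-!
# Prime pairs `p, p + h ≤ N`: Brun–Titchmarsh uniformly in the shift, counting form
(crux `TwinLowerDensityToGHL`, stmt-Parity-18380; corollary of `uniformUpperCount`)

The classical statement behind every "Goldbach/twin exceptional set" argument, as the `t = 2`, unit-slope
slice of the uniform counting rung `uniformUpperCount` (`Theorems/TwinLowerDensityToGHLUniformUpperBoundCount.lean`):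
ONE constant `C` with

  `#{1 ≤ n ≤ N : n and n + h both prime} ≤ C · 𝔖(h) · N / log² N + ε N / log² N`   for ALL `1 ≤ h ≤ N`,

`N ≥ N₀(ε)`, `𝔖(h) = goldbachSingularSeries h` (`= 2 C₂ ∏_{p ∣ h, p > 2} (p−1)/(p−2)` for even `h`, `0` for odd
`h`).  Ingredients: the count dictionary `primePointCount_shiftPairSystem` (this file: the prime-point count of
`(n, n + h)` on `[-N, N]` is the displayed cardinality), `archFactor_shiftPairSystem` (`β_∞ = N`) and
`singularProduct_shiftPairSystem` / the vanishing local factor at `2` for odd `h` (tree dictionary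
`Theorems/PairsToGHL/Negative/ShiftPairDictionary.lean`).  Upper half only, constant lost: the asymptotic
`~ 𝔖(h) N/log² N` uniformly in `h ≤ N` is the pair slice of Green–Tao's Conj. 1.4 / of stmt-Parity-0819.

References: H. Halberstam, H.-E. Richert, *Sieve Methods* (1974), Thm. 3.11, Thm. 2.5, §5.7
[HalberstamRichert1974]; B. Green, T. Tao, Ann. of Math. 171 (2010), Example 1, Conj. 1.4 [GreenTao2010].
-/

noncomputable section

open Finset Filter

namespace Summit.Parity.GeneralizedHardyLittlewood.TwinLowerDensityToGHLUniformUpperBound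

open Literature.NumberTheory.Sieve
open Summit.Parity.GeneralizedHardyLittlewood.Theorems.PairsToGHL.Negative

/-- **Count dictionary for `(n, n + h)` on `[-N, N]`**: the Green–Tao prime-point count of the shift-pair
system over the full box is `#{1 ≤ n ≤ N : n, n + h prime}` (points `m ≤ 0` have `m.toNat = 0`, not prime).
[cite: GreenTao2010, (1.8) and Example 1] -/
theorem primePointCount_shiftPairSystem (h N : ℕ) :
    primePointCount (shiftPairSystem (h : ℤ)) (realBox 1 N) N =
      #((Icc 1 N).filter (fun n => n.Prime ∧ (n + h).Prime)) := by
  classical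
  unfold primePointCount
  rw [DimOne.card_filter_latticeBox]
  refine Finset.card_nbij' (fun m => m.toNat) (fun n => (n : ℤ)) (fun m hm => ?_) (fun n hn => ?_)
    (fun m hm => ?_) (fun n _ => by simp)
  · -- `ℤ`-side point ↦ `ℕ`-side point
    rw [Finset.mem_coe, Finset.mem_filter] at hm
    obtain ⟨hmI, -, hpr⟩ := hm
    have h0 := hpr 0
    have h1 := hpr 1
    rw [shiftPairSystem_eval_zero] at h0
    rw [shiftPairSystem_eval_one] at h1
    have hm2 : 2 ≤ m.toNat := h0.two_le
    have hm0 : 0 ≤ m := by omega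
    have hmh : (m + (h : ℤ)).toNat = m.toNat + h := by omega
    have hmN := (Finset.mem_Icc.mp hmI).2
    dsimp only
    rw [Finset.mem_coe, Finset.mem_filter, Finset.mem_Icc]
    exact ⟨⟨by omega, by omega⟩, h0, hmh ▸ h1⟩
  · -- `ℕ`-side point ↦ `ℤ`-side point
    rw [Finset.mem_coe, Finset.mem_filter, Finset.mem_Icc] at hn
    obtain ⟨⟨hn1, hnN⟩, hp, hph⟩ := hn
    dsimp only
    rw [Finset.mem_coe, Finset.mem_filter, Finset.mem_Icc]
    refine ⟨⟨by omega, by exact_mod_cast hnN⟩, ?_, ?_⟩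
    · simp only [realBox, DimOne.realPoint_const, Set.mem_Icc, Pi.le_def]
      refine ⟨fun _ => ?_, fun _ => ?_⟩
      · have : (0 : ℝ) ≤ (n : ℤ) := by exact_mod_cast Int.natCast_nonneg n
        push_cast at this ⊢
        have hN0 : (0 : ℝ) ≤ N := Nat.cast_nonneg N
        linarith
      · exact_mod_cast hnN
    · intro i
      fin_cases i
      · show ((shiftPairSystem (h : ℤ) 0).eval (fun _ => (n : ℤ))).toNat.Prime
        rw [shiftPairSystem_eval_zero, Int.toNat_natCast]; exact hp
      · show ((shiftPairSystem (h : ℤ) 1).eval (fun _ => (n : ℤ))).toNat.Prime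
        rw [shiftPairSystem_eval_one, show ((n : ℤ) + (h : ℤ)) = ((n + h : ℕ) : ℤ) by push_cast; ring,
          Int.toNat_natCast]
        exact hph
  · -- left inverse
    rw [Finset.mem_coe, Finset.mem_filter] at hm
    have h0 := hm.2.2 0
    rw [shiftPairSystem_eval_zero] at h0
    have hm2 : 2 ≤ m.toNat := h0.two_le
    show ((m.toNat : ℕ) : ℤ) = m
    omega

/-- **Prime pairs with a given difference, uniformly in the difference (Brun–Titchmarsh, counting form)**:
there is `C > 0` such that for every `ε > 0`, all large `N` and ALL `1 ≤ h ≤ N`,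
`#{1 ≤ n ≤ N : n, n + h prime} ≤ C · 𝔖(h) · N / log² N + ε N / log² N`, `𝔖(h) = goldbachSingularSeries h`
(`0` for odd `h`). [cite: HalberstamRichert1974, Thm. 3.11 and Thm. 2.5] [cite: GreenTao2010, Example 1] -/
theorem pairCount_uniformShift :
    ∃ C : ℝ, 0 < C ∧ ∀ ε : ℝ, 0 < ε → ∃ N₀ : ℕ, ∀ N : ℕ, N₀ ≤ N → ∀ h : ℕ, 1 ≤ h → h ≤ N →
      (#((Icc 1 N).filter (fun n => n.Prime ∧ (n + h).Prime)) : ℝ) ≤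
        C * (goldbachSingularSeries h * N) / Real.log N ^ 2 + ε * N / Real.log N ^ 2 := by
  obtain ⟨C, hC, hmain⟩ := uniformUpperCount 2 3 (by norm_num)
  refine ⟨C, hC, fun ε hε => ?_⟩
  obtain ⟨N₀, hN₀⟩ := hmain ε hε
  refine ⟨max N₀ 1, fun N hN h hh hhN => ?_⟩
  have hNpos : 0 < N := lt_of_lt_of_le zero_lt_one (le_of_max_le_right hN)
  have h0 : h ≠ 0 := by omega
  have hnd : IsNondegenerateSystem (shiftPairSystem (h : ℤ)) :=
    isNondegenerateSystem_shiftPairSystem_iff.mpr (by exact_mod_cast h0)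
  have key := hN₀ N (le_of_max_le_left hN) (shiftPairSystem (h : ℤ)) hnd
    (affLinSize_shiftPairSystem_le hNpos hhN) (realBox 1 N) (convex_Icc _ _) subset_rfl
  have hSP : singularProduct (shiftPairSystem (h : ℤ)) = goldbachSingularSeries h := by
    rcases Nat.even_or_odd h with he | ho
    · exact singularProduct_shiftPairSystem he h0
    · have h2 : ¬ 2 ∣ h := fun hd => (Nat.not_even_iff_odd.mpr ho) (even_iff_two_dvd.mpr hd)
      have hβ : localFactor (shiftPairSystem (h : ℤ)) 2 = 0 := by
        rw [localFactor_shiftPairSystem_of_not_dvd Nat.prime_two h2]; norm_num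
      rw [singularProduct_eq_zero_of_localFactor_eq_zero _ hnd Nat.prime_two hβ]
      unfold goldbachSingularSeries
      rw [if_pos ho]
  rw [primePointCount_shiftPairSystem, archFactor_shiftPairSystem, hSP, mul_comm (N : ℝ)] at key
  exact key

end Summit.Parity.GeneralizedHardyLittlewood.TwinLowerDensityToGHLUniformUpperBound

end
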